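import Literature.AlgebraicGeometry.Motives.AbelianVarietyConjugateBaseChangeAlong
import Literature.AlgebraicGeometry.Motives.AbelianVarietyIsogenyModelDescent
import HarnessLib

/-!
# Main theorem of complex multiplication — `κ` READ ON THE JUNCTION CARRIER `(A₀ ⊗ ℂ)^σ`:
# «`x^σ = κ(x)` for the `L₁`-rational torsion points `x`», transported from the model `A₀ ⊗_L L₁` to `A₀ ⊗ ℂ`

[Shimura1998] G. Shimura, *Abelian Varieties with Complex Multiplication and Modular Functions*, Princeton 1998,
§18.6, proof of Thm. 18.6, p. 128 («Let us now take `t ∈ A` such that `Mt = 0`. Then … `t^σ = κt`», read on the complex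
points although `κ` and the congruence relation live on the model over the number field) and pp. 127–129 («`A^σ`,
`t^σ` computed on the model»).

Topic: GLUE for row II-1 S7a `levelStructure` (cell `hodgecm-mathlib`, D-0151; B-p12's decomposition, piece G11a's
hypothesis `hFG` of `MainTheoremCMLevelTorsionTransport.forall_conj_eq_of_eq_on_torsion`; director g2 BATCH 16 «κ read on
the junction carrier», cut with B-p20 05:45:43Z).  Theorems only: no definition, no instance, no named fact.

SETTING.  `L ⊆ L₁ ⊆ ℂ` (any tower of fields), `A₀` over `L`, the model `A₀ ⊗_L L₁`, `γ ∈ Aut(L₁)`, `σ ∈ Aut(ℂ)` extending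
`γ` (`hσ`), a homomorphism `κ : A₀ ⊗_L L₁ → (A₀ ⊗_L L₁)^γ` over `L₁` (G10's `κ = λ ≫ θ`, `MainTheoremCMLevelKappa`), and
the two canonical isomorphisms of B-p20's `MainTheoremCMLevelUniformizationTransport`:
`T = baseChangeTowerIso L L₁ ℂ A₀ : (A₀ ⊗_L L₁) ⊗ ℂ ≅ A₀ ⊗ ℂ` and
`E = e₁ ≫ T^σ : ((A₀ ⊗_L L₁)^γ) ⊗ ℂ ≅ (A₀ ⊗ ℂ)^σ`, `e₁ = conjugateBaseChangeAlongIso γ σ hσ (A₀ ⊗_L L₁)` (p602992).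

* `AbelianVariety.conjPoints_map_baseChangeTowerIso_eq_of_map_eq_conjPoints` — for ONE `L₁`-point `x` of the model with
  `κ(x) = x^γ`: the conjugate `(T x_ℂ)^σ ∈ (A₀ ⊗ ℂ)^σ(ℂ)` of its complex point IS `E(κ_ℂ(x_ℂ))` — the points formula
  `e₁((x^γ)_ℂ) = (x_ℂ)^σ` of `Motives/AbelianVarietyConjugateBaseChangeAlong` + naturality of `x ↦ x^σ` along `T`
  (`conjPoints_map`) + base change of points along `κ` (`pointsMulEquiv_extendScalars_map`).
* `AbelianVariety.conjPoints_eq_map_of_forall_torsion` (and `…_map_comp_…`, one composite points map) — the `hFG` shape of G11a: if every `N`-torsion point of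
  `(A₀ ⊗ ℂ)(ℂ)` comes from an `N`-torsion `L₁`-point of the model (G2, `L₁ ⊇ L(A₀[N])`) and `κ = γ` on those (the
  congruence relation, from II-1-S5c's (2′)), then `P^σ = E(κ_ℂ(T⁻¹ P))` for every `P ∈ (A₀ ⊗ ℂ)[N](ℂ)`.
HC_CM is proved only modulo the printed citations until rung 0 closes.
-/

noncomputable section

open CategoryTheory CategoryTheory.Limits AlgebraicGeometry
open Literature.AlgebraicGeometry.Motives Literature.AlgebraicGeometry.Motives.AbelianVariety

namespace Literature.NumberTheory.ComplexMultiplication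

variable {L L₁ : Type} [Field L] [Field L₁] [Algebra L L₁] [Algebra L₁ ℂ] [Algebra L ℂ] [IsScalarTower L L₁ ℂ]
  (A₀ : AbelianVariety L) (γ : L₁ ≃+* L₁) (σ : ℂ ≃+* ℂ)
  (hσ : ∀ x : L₁, σ (algebraMap L₁ ℂ x) = algebraMap L₁ ℂ (γ x))

/-- **`κ` read on the junction carrier, one point**: for an `L₁`-point `x` of the model `A₀ ⊗_L L₁` with `κ(x) = x^γ`
(«`t^σ = κ(t)`» on the model), the conjugate by `σ` of its complex point `T(x_ℂ) ∈ (A₀ ⊗ ℂ)(ℂ)` is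
`E(κ_ℂ(x_ℂ)) ∈ (A₀ ⊗ ℂ)^σ(ℂ)`, `E = e₁ ≫ T^σ` — Shimura's «`A^σ`, `t^σ` computed on the model» made explicit:
`(T x_ℂ)^σ = T^σ((x_ℂ)^σ)` (`conjPoints_map`), `(x_ℂ)^σ = e₁((x^γ)_ℂ)` (the points formula of
`conjugateBaseChangeAlongIso`), `(x^γ)_ℂ = (κ x)_ℂ = κ_ℂ(x_ℂ)` (`pointsMulEquiv_extendScalars_map`).
[cite: Shimura1998, §18.6 proof of Thm. 18.6, p. 128 («t^σ = κt») and pp. 127–129] [cite: Milne2005ShimuraVarieties, §11 p. 108 («σP ∈ σA»)] -/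
theorem AbelianVariety.conjPoints_map_baseChangeTowerIso_eq_of_map_eq_conjPoints
    (κ : A₀.baseChange L₁ ⟶ (A₀.baseChange L₁).conjugate γ) (x : (A₀.baseChange L₁).Points L₁)
    (hκx : AlgPoints.map κ.hom.hom.hom x = (A₀.baseChange L₁).conjPoints γ x) :
    (A₀.baseChange ℂ).conjPoints σ
        (AlgPoints.map (baseChangeTowerIso L L₁ ℂ A₀).hom.hom.hom.hom
          ((A₀.baseChange L₁).pointsMulEquiv ℂ (AlgPoints.extendScalars (A₀.baseChange L₁).X L₁ ℂ x))) =
      AlgPoints.map ((conjugateBaseChangeAlongIso γ σ hσ (A₀.baseChange L₁)).hom ≫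
            Hom.conjugate σ (baseChangeTowerIso L L₁ ℂ A₀).hom).hom.hom.hom
        (AlgPoints.map (Hom.baseChange ℂ κ).hom.hom.hom
          ((A₀.baseChange L₁).pointsMulEquiv ℂ (AlgPoints.extendScalars (A₀.baseChange L₁).X L₁ ℂ x))) := by
  rw [conjPoints_map, ← map_conjugateBaseChangeAlongIso_hom_pointsMulEquiv_extendScalars_conjPoints γ σ hσ,
    ← hκx, ← pointsMulEquiv_extendScalars_map]
  change _ = AlgPoints.map ((conjugateBaseChangeAlongIso γ σ hσ (A₀.baseChange L₁)).hom.hom.hom.hom ≫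
    (Hom.conjugate σ (baseChangeTowerIso L L₁ ℂ A₀).hom).hom.hom.hom) _
  rw [AlgPoints.map_comp_apply]

/-- **`κ` read on the junction carrier, on `N`-torsion** — the `hFG` hypothesis of
`CMTypeUniformization.forall_conj_eq_of_eq_on_torsion` (G11a) with `F := (x ↦ x^σ)` and
`G := E ∘ κ_ℂ ∘ T⁻¹`: if every `N`-torsion complex point of `A₀ ⊗ ℂ` comes through `T` from an `N`-torsion `L₁`-RATIONAL
point of the model (`hrat`; [Shimura1998] p. 127 (i) «the points on `A_i` annihilated by `M` are all rational over `L`» — G2) and `κ` acts as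
`γ` on those (`hκ`; the congruence relation «`t^σ = κ(t)`», from II-1-S5c), then `P^σ = E(κ_ℂ(T⁻¹ P))` for every
`P ∈ (A₀ ⊗ ℂ)[N](ℂ)`. [cite: Shimura1998, §18.6 proof of Thm. 18.6, p. 127 (i) and p. 128 («take t ∈ A such that Mt = 0 … t^σ = κt»)] -/
theorem AbelianVariety.conjPoints_eq_map_of_forall_torsion
    (κ : A₀.baseChange L₁ ⟶ (A₀.baseChange L₁).conjugate γ) (N : ℤ)
    (hrat : ∀ P ∈ (A₀.baseChange ℂ).torsionPoints ℂ N, ∃ x : (A₀.baseChange L₁).Points L₁,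
      x ∈ (A₀.baseChange L₁).torsionPoints L₁ N ∧
        AlgPoints.map (baseChangeTowerIso L L₁ ℂ A₀).hom.hom.hom.hom
          ((A₀.baseChange L₁).pointsMulEquiv ℂ (AlgPoints.extendScalars (A₀.baseChange L₁).X L₁ ℂ x)) = P)
    (hκ : ∀ x ∈ (A₀.baseChange L₁).torsionPoints L₁ N,
      AlgPoints.map κ.hom.hom.hom x = (A₀.baseChange L₁).conjPoints γ x)
    (P : (A₀.baseChange ℂ).Points ℂ) (hP : P ∈ (A₀.baseChange ℂ).torsionPoints ℂ N) :
    (A₀.baseChange ℂ).conjPoints σ P =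
      AlgPoints.map ((conjugateBaseChangeAlongIso γ σ hσ (A₀.baseChange L₁)).hom ≫
            Hom.conjugate σ (baseChangeTowerIso L L₁ ℂ A₀).hom).hom.hom.hom
        (AlgPoints.map (Hom.baseChange ℂ κ).hom.hom.hom
          (AlgPoints.map (baseChangeTowerIso L L₁ ℂ A₀).inv.hom.hom.hom P)) := by
  obtain ⟨x, hx, rfl⟩ := hrat P hP
  rw [AbelianVariety.conjPoints_map_baseChangeTowerIso_eq_of_map_eq_conjPoints A₀ γ σ hσ κ x (hκ x hx),
    ← AlgPoints.map_comp_apply (baseChangeTowerIso L L₁ ℂ A₀).hom.hom.hom.hom]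
  have h : (baseChangeTowerIso L L₁ ℂ A₀).hom.hom.hom.hom ≫ (baseChangeTowerIso L L₁ ℂ A₀).inv.hom.hom.hom = 𝟙 _ :=
    congr_arg (fun f : (A₀.baseChange L₁).baseChange ℂ ⟶ (A₀.baseChange L₁).baseChange ℂ => f.hom.hom.hom)
      (baseChangeTowerIso L L₁ ℂ A₀).hom_inv_id
  rw [h, AlgPoints.map_id_apply]

/-- **The same with `G` as ONE points map** of the composite `κ_ℂ ≫ e₁ ≫ T^σ` after `T⁻¹` (the shape quoted in the
G11a slot line: `G := AlgPoints.map (Hom.baseChange ℂ κ ≫ e₁ ≫ T^σ).hom.hom.hom ∘ AlgPoints.map T⁻¹`).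
[cite: Shimura1998, §18.6 proof of Thm. 18.6, p. 128] -/
theorem AbelianVariety.conjPoints_eq_map_comp_of_forall_torsion
    (κ : A₀.baseChange L₁ ⟶ (A₀.baseChange L₁).conjugate γ) (N : ℤ)
    (hrat : ∀ P ∈ (A₀.baseChange ℂ).torsionPoints ℂ N, ∃ x : (A₀.baseChange L₁).Points L₁,
      x ∈ (A₀.baseChange L₁).torsionPoints L₁ N ∧
        AlgPoints.map (baseChangeTowerIso L L₁ ℂ A₀).hom.hom.hom.hom
          ((A₀.baseChange L₁).pointsMulEquiv ℂ (AlgPoints.extendScalars (A₀.baseChange L₁).X L₁ ℂ x)) = P)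
    (hκ : ∀ x ∈ (A₀.baseChange L₁).torsionPoints L₁ N,
      AlgPoints.map κ.hom.hom.hom x = (A₀.baseChange L₁).conjPoints γ x)
    (P : (A₀.baseChange ℂ).Points ℂ) (hP : P ∈ (A₀.baseChange ℂ).torsionPoints ℂ N) :
    (A₀.baseChange ℂ).conjPoints σ P =
      AlgPoints.map (Hom.baseChange ℂ κ ≫ (conjugateBaseChangeAlongIso γ σ hσ (A₀.baseChange L₁)).hom ≫
            Hom.conjugate σ (baseChangeTowerIso L L₁ ℂ A₀).hom).hom.hom.hom
        (AlgPoints.map (baseChangeTowerIso L L₁ ℂ A₀).inv.hom.hom.hom P) := by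
  rw [AbelianVariety.conjPoints_eq_map_of_forall_torsion A₀ γ σ hσ κ N hrat hκ P hP]
  change _ = AlgPoints.map ((Hom.baseChange ℂ κ).hom.hom.hom ≫
    ((conjugateBaseChangeAlongIso γ σ hσ (A₀.baseChange L₁)).hom ≫
      Hom.conjugate σ (baseChangeTowerIso L L₁ ℂ A₀).hom).hom.hom.hom) _
  rw [AlgPoints.map_comp_apply]

end Literature.NumberTheory.ComplexMultiplication

end
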